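import Summits.CriticalPhenomena.PercolationContinuityZ3.Theses.PercBurnResprinkle
import Summits.CriticalPhenomena.PercolationContinuityZ3.Theorems.PercBurnResprinkleVacantSetPercolatesCoarseLocality
import Summits.CriticalPhenomena.PercolationContinuityZ3.Theorems.PercBurnResprinkleVacantSetPercolatesCoarseShift
import Summits.CriticalPhenomena.PercolationContinuityZ3.Theorems.PercBurnResprinkleVacantSetPercolatesCoarseFootprint
import Summits.CriticalPhenomena.PercolationContinuityZ3.Theorems.PercBurnResprinkleVacantSetPercolatesCoarsePercolates
import Summits.CriticalPhenomena.PercolationContinuityZ3.Theorems.PercBurnResprinkleVacantSetPercolatesSquareCrossings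
import Summits.CriticalPhenomena.PercolationContinuityZ3.Theorems.PercBurnResprinkleVacantSetPercolatesCoarseToVacant
import Literature.Probability.Percolation.FiniteClustersPercolationOneArm
import Literature.Probability.Percolation.SiteConnectionTools
import Literature.Probability.Percolation.BondPercolationSymmetry
import HarnessLib

/-!
# Crux `PercBurnResprinkle.VacantSetPercolates` (stmt-CriticalPhenomena-7205), line `planar-armed-sections`:
# the crux REDUCED TO ONE PLANAR FINITE-SIZE CRITERION AT `p_c(ℤ³)`

Lead prover-line-stmt-CriticalPhenomena-7205-0, 2026-08-16.  Composes the six landed stubs of the line (`stub_coarseLocality`,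
`stub_coarseShift`, `stub_coarseFootprint`, `stub_coarsePercolates`: a static, finitely dependent planar renormalisation of the
QUIET field of `ℤ³` sectioned by the coordinate plane; `stub_squareCrossings`, `stub_coarseToVacant`: its planar gluing and the
lift to GHK's graph `X = ℤ³[{y : C(y) finite}]`) with continuity in `p` of local probabilities and `p_c(ℤ³) < 1`:
* `criticalProb_lt_pFin_of_planarQuietCrossings` / `vacantSetPercolates_of_planarArmedFSC` / `stub_planarArmedSectionsTransfer` — `p_c(ℤ³) < p_fin(3)`,
  resp. the route decl `VacantSetPercolates`, follow from the registered open stub `stub_planarArmedFSC` (verbatim): for every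
  `ε > 0` there are scales `1 ≤ n`, `2n < N` at which, under `P_{p_c(ℤ³)}`, both `2N × N` origin rectangles of the coordinate
  plane are crossed the long way by a lattice path of `n`-QUIET sites (`planeEmb 3 w ∈ quietSet n ω`: no open path from `(w,0)`
  to the boundary of its `n`-box inside the box) with probability `≥ 1 - ε`;
* `PlanarArmedSections.real_quietCross_mono` (the criterion probability is non-decreasing in `n`) and
  `PlanarArmedSections.real_quietCross_dir_one_eq` (direction symmetry, coordinate swap of `ℤ³`) give the EQUIVALENT
  single-orientation, one-parameter form — `vacantSetPercolates_of_dir0HalfScaleQuietCrossings`: the crux from "for every `ε > 0`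
  some `N ≥ 3` at which `[0,2N] × [0,N] × {0}` is crossed HORIZONTALLY by `(N-1)/2`-quiet sites with `P_{p_c}`-probability `≥ 1 - ε`"
  (the statement to promote; conversions `planarArmedFSC_of_halfScaleQuietCrossings`, `halfScaleQuietCrossings_of_planarArmedFSC`,
  `halfScaleQuietCrossings_of_dir0`, `dir0_of_halfScaleQuietCrossings`).
So the crux is CLOSED MODULO `stub_planarArmedFSC` (finite volume, one parameter at the symbol `p_c`; MC-true: kit j012544 E2).
No one-arm bound, no sprinkling, no `p ↓ p_c` limit is used (Disproof §7 does not bite); all gluing is planar.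
Proof of the engine (GHK 2014 §4 architecture, block crossings instead of the one-arm density bound): `η₀` from
`stub_coarsePercolates`; the input at `ε = η₀/2`; continuity of `p ↦ P_p(crossing)` (`stub_coarseLocality`, `stub_coarseShift`,
`continuous_bondPercolation_real_of_determinedBy`) and `criticalProb_zd_lt_one` give `q ∈ (p_c, 1]` with both bounds; coarse
percolation at `q`; gluing on `{ω ⊆ E(ℤ³)}` (`stub_coarseToVacant` fed `stub_squareCrossings`); `q ≤ p_fin(3)`.
-/


noncomputable section

namespace Summit.CriticalPhenomena.PercolationContinuityZ3.Theorems

open MeasureTheory Set Filter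
open scoped Topology
open Literature.Probability.Percolation Literature.Probability.LatticeModels

/-! ### Monotonicity in the arm scale and direction symmetry (helpers) -/

namespace PlanarArmedSections

/-- Arm events are ANTITONE in the radius: an open arm from `v` to the boundary of `v + Λ_{m'}` inside that box exits every
smaller box `v + Λ_m`, `m ≤ m'`, through its boundary (first exit; for configurations supported on `E(ℤ³)`). [folklore] -/
theorem armEvent_anti {ω : BondConfig (Site 3)} (hω : ω ⊆ (zdGraph 3).edgeSet) {v : Site 3} {m m' : ℕ}
    (hm : m ≤ m') (h : ω ∈ DCT16.armEvent v m') : ω ∈ DCT16.armEvent v m := by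
  rcases hm.lt_or_eq with hlt | rfl
  · obtain ⟨a, ha, hconn⟩ := h
    exact DCT16.armEvent_of_pathIn hω (DCT16.mem_openConnIn_iff_pathIn.1 hconn)
      (Or.inl (DCT16.notMem_box_of_mem_innerBoundary_box hlt ha))
  · exact h

/-- Quiet sets GROW with the scale (no arm to distance `m` ⇒ none to distance `m' ≥ m`; `ω ⊆ E(ℤ³)`). [folklore] -/
theorem quietSet_mono {ω : BondConfig (Site 3)} (hω : ω ⊆ (zdGraph 3).edgeSet) {m m' : ℕ} (hm : m ≤ m') :
    quietSet m ω ⊆ quietSet m' ω :=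
  fun _ hx h => hx (armEvent_anti hω hm h)

/-- The criterion probability is NON-DECREASING in the arm scale `n` (block scale `N` and direction `k` fixed): enlarging
`n` enlarges the quiet set, hence the set of admissible crossing paths (a.s., `ω ⊆ E(ℤ³)`). So in `stub_planarArmedFSC`
the best arm scale is the largest admissible one, `n = (N - 1) / 2`. [folklore] -/
theorem real_quietCross_mono (p : unitInterval) {n n' : ℕ} (hn : n ≤ n') (N : ℕ) (k : Fin 2) :
    (bondPercolation (zdGraph 3) p).real
        {ω | ∃ x y : Site 2, x k = 0 ∧ y k = 2 * (N : ℤ) ∧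
          PathIn (zdGraph 2) ({w : Site 2 | (0 ≤ w k ∧ w k ≤ 2 * (N : ℤ)) ∧
            ∀ j : Fin 2, j ≠ k → 0 ≤ w j ∧ w j ≤ (N : ℤ)} ∩ {w | planeEmb 3 w ∈ quietSet n ω}) x y} ≤
      (bondPercolation (zdGraph 3) p).real
        {ω | ∃ x y : Site 2, x k = 0 ∧ y k = 2 * (N : ℤ) ∧
          PathIn (zdGraph 2) ({w : Site 2 | (0 ≤ w k ∧ w k ≤ 2 * (N : ℤ)) ∧
            ∀ j : Fin 2, j ≠ k → 0 ≤ w j ∧ w j ≤ (N : ℤ)} ∩ {w | planeEmb 3 w ∈ quietSet n' ω}) x y} := by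
  refine DCT16.real_mono_of_forall_subset_edgeSet (zdGraph 3) p fun ω hω h => ?_
  obtain ⟨x, y, hx, hy, hpath⟩ := h
  exact ⟨x, y, hx, hy, hpath.mono (Set.inter_subset_inter_right _ fun w hw => quietSet_mono hω hn hw)⟩

/-- Signed coordinate permutations are `ℤ`-linear: they commute with subtraction. [folklore] -/
theorem signedPerm_sub {d : ℕ} (π : Equiv.Perm (Fin d)) (ε : Fin d → ℤˣ) (x y : Site d) :
    Site.signedPerm π ε (x - y) = Site.signedPerm π ε x - Site.signedPerm π ε y := by
  funext i; simp [mul_sub]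

/-- Signed coordinate permutations preserve the inner boundary of the boxes `Λ_n`. [folklore] -/
theorem signedPerm_mem_innerBoundary_box_iff {d : ℕ} (π : Equiv.Perm (Fin d)) (ε : Fin d → ℤˣ) {n : ℕ}
    {x : Site d} :
    Site.signedPerm π ε x ∈ innerBoundary (zdGraph d) (box d n) ↔ x ∈ innerBoundary (zdGraph d) (box d n) := by
  simp only [mem_innerBoundary_iff, signedPerm_mem_box_iff]
  refine and_congr_right fun _ => ⟨?_, ?_⟩
  · rintro ⟨y, hy, hadj⟩
    refine ⟨(Site.signedPerm π ε).symm y, ?_, ?_⟩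
    · rwa [← signedPerm_mem_box_iff π ε, Equiv.apply_symm_apply]
    · have h := zdGraph_adj_signedPerm π.symm (ε ∘ π) hadj
      rw [← Site.signedPerm_symm, Equiv.symm_apply_apply] at h
      rwa [Site.signedPerm_symm]
  · rintro ⟨y, hy, hadj⟩
    exact ⟨Site.signedPerm π ε y, by rwa [signedPerm_mem_box_iff], zdGraph_adj_signedPerm π ε hadj⟩

/-- **Transport of arm events under a signed coordinate permutation `σ` of `ℤ^d`**: `σ '' ω` has an arm at `σ v` iff
`ω` has an arm at `v` (boxes and their inner boundaries are `σ`-invariant, `σ` is additive and a graph automorphism). [folklore] -/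
theorem relabel_signedPerm_mem_armEvent_iff {d : ℕ} (π : Equiv.Perm (Fin d)) (ε : Fin d → ℤˣ)
    (ω : BondConfig (Site d)) (v : Site d) (m : ℕ) :
    BondConfig.relabel (sym2Equiv (Site.signedPerm π ε)) ω ∈ DCT16.armEvent (Site.signedPerm π ε v) m ↔
      ω ∈ DCT16.armEvent v m := by
  set σ := Site.signedPerm π ε with hσ
  constructor
  · rintro ⟨a, ha, hconn⟩
    have hpath := DCT16.mem_openConnIn_iff_pathIn.1 hconn
    refine ⟨σ.symm a, ?_, DCT16.mem_openConnIn_iff_pathIn.2 ?_⟩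
    · rw [← signedPerm_mem_innerBoundary_box_iff π ε, hσ.symm, signedPerm_sub, Equiv.apply_symm_apply]
      simpa [hσ] using ha
    · have h := DCT16.pathIn_map (G' := openGraph ω) σ.symm (A := {z : Site d | z - σ v ∈ box d m})
        (B := {z : Site d | z - v ∈ box d m}) (fun z hz => ?_) (fun a b _ _ hab => ?_) hpath
      · simpa [hσ] using h
      · simp only [Set.mem_setOf_eq] at hz ⊢
        rw [← signedPerm_mem_box_iff π ε, ← hσ, signedPerm_sub, Equiv.apply_symm_apply]
        exact hz
      · rw [← openGraph_relabel_adj_iff σ ω, Equiv.apply_symm_apply, Equiv.apply_symm_apply]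
        exact hab
  · rintro ⟨a, ha, hconn⟩
    have hpath := DCT16.mem_openConnIn_iff_pathIn.1 hconn
    refine ⟨σ a, ?_, DCT16.mem_openConnIn_iff_pathIn.2 ?_⟩
    · rw [← signedPerm_sub]
      exact (signedPerm_mem_innerBoundary_box_iff π ε).2 ha
    · exact DCT16.pathIn_map (G' := openGraph (BondConfig.relabel (sym2Equiv σ) ω)) σ
        (A := {z : Site d | z - v ∈ box d m}) (B := {z : Site d | z - σ v ∈ box d m})
        (fun z hz => by
          simp only [Set.mem_setOf_eq] at hz ⊢
          rw [← signedPerm_sub]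
          exact (signedPerm_mem_box_iff π ε).2 hz)
        (fun a b _ _ hab => (openGraph_relabel_adj_iff σ ω a b).2 hab) hpath

/-- The coordinate swaps of the plane and of `ℤ³` (`0 ↔ 1`) commute with the embedding `planeEmb 3`. [folklore] -/
theorem planeEmb_swap (w : Site 2) :
    planeEmb 3 (Site.signedPerm (Equiv.swap (0 : Fin 2) 1) 1 w) =
      Site.signedPerm (Equiv.swap (0 : Fin 3) 1) 1 (planeEmb 3 w) := by
  funext j
  fin_cases j <;> simp [planeEmb_apply, Site.signedPerm_apply, Equiv.swap_apply_def]

/-- **DIRECTION SYMMETRY of the planar quiet-crossing criterion**: under `P_p` the long-way quiet crossing of the origin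
rectangle in direction `1` has the probability of the one in direction `0` (coordinate swap `0 ↔ 1` of `ℤ³`, which fixes
the coordinate plane, permutes the quiet field and exchanges the two rectangles). [folklore] -/
theorem real_quietCross_dir_one_eq (p : unitInterval) (n N : ℕ) :
    (bondPercolation (zdGraph 3) p).real
        {ω | ∃ x y : Site 2, x 1 = 0 ∧ y 1 = 2 * (N : ℤ) ∧
          PathIn (zdGraph 2) ({w : Site 2 | (0 ≤ w 1 ∧ w 1 ≤ 2 * (N : ℤ)) ∧
            ∀ j : Fin 2, j ≠ 1 → 0 ≤ w j ∧ w j ≤ (N : ℤ)} ∩ {w | planeEmb 3 w ∈ quietSet n ω}) x y} =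
      (bondPercolation (zdGraph 3) p).real
        {ω | ∃ x y : Site 2, x 0 = 0 ∧ y 0 = 2 * (N : ℤ) ∧
          PathIn (zdGraph 2) ({w : Site 2 | (0 ≤ w 0 ∧ w 0 ≤ 2 * (N : ℤ)) ∧
            ∀ j : Fin 2, j ≠ 0 → 0 ≤ w j ∧ w j ≤ (N : ℤ)} ∩ {w | planeEmb 3 w ∈ quietSet n ω}) x y} := by
  set τ : Site 2 ≃ Site 2 := Site.signedPerm (Equiv.swap (0 : Fin 2) 1) 1 with hτ
  set σ : Site 3 ≃ Site 3 := Site.signedPerm (Equiv.swap (0 : Fin 3) 1) 1 with hσ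
  have hτ0 : ∀ w : Site 2, τ w 0 = w 1 := fun w => by simp [hτ]
  have hτ1 : ∀ w : Site 2, τ w 1 = w 0 := fun w => by simp [hτ]
  have hττ : ∀ w : Site 2, τ (τ w) = w := fun w => by
    funext i; fin_cases i <;> simp [hτ]
  have hquiet : ∀ (ω : BondConfig (Site 3)) (w : Site 2),
      planeEmb 3 w ∈ quietSet n (BondConfig.relabel (sym2Equiv σ) ω) ↔ planeEmb 3 (τ w) ∈ quietSet n ω := by
    intro ω w
    rw [mem_quietSet, mem_quietSet, not_iff_not]
    have h := relabel_signedPerm_mem_armEvent_iff (Equiv.swap (0 : Fin 3) 1) 1 ω (planeEmb 3 (τ w)) n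
    rw [← hσ, ← planeEmb_swap, ← hτ, hττ] at h
    exact h
  have hadjτ : ∀ a b : Site 2, (zdGraph 2).Adj a b → (zdGraph 2).Adj (τ a) (τ b) := fun a b h =>
    zdGraph_adj_signedPerm _ _ h
  have hset :
      {ω : BondConfig (Site 3) | ∃ x y : Site 2, x 1 = 0 ∧ y 1 = 2 * (N : ℤ) ∧
          PathIn (zdGraph 2) ({w : Site 2 | (0 ≤ w 1 ∧ w 1 ≤ 2 * (N : ℤ)) ∧
            ∀ j : Fin 2, j ≠ 1 → 0 ≤ w j ∧ w j ≤ (N : ℤ)} ∩ {w | planeEmb 3 w ∈ quietSet n ω}) x y} =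
        BondConfig.relabel (sym2Equiv σ) ⁻¹'
          {ω | ∃ x y : Site 2, x 0 = 0 ∧ y 0 = 2 * (N : ℤ) ∧
            PathIn (zdGraph 2) ({w : Site 2 | (0 ≤ w 0 ∧ w 0 ≤ 2 * (N : ℤ)) ∧
              ∀ j : Fin 2, j ≠ 0 → 0 ≤ w j ∧ w j ≤ (N : ℤ)} ∩ {w | planeEmb 3 w ∈ quietSet n ω}) x y} := by
    ext ω
    simp only [Set.mem_setOf_eq, Set.mem_preimage]
    constructor
    · rintro ⟨x, y, hx, hy, hpath⟩
      refine ⟨τ x, τ y, by rw [hτ0]; exact hx, by rw [hτ0]; exact hy, ?_⟩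
      refine DCT16.pathIn_map τ (fun w hw => ?_) (fun a b _ _ hab => hadjτ a b hab) hpath
      obtain ⟨⟨h1, h2⟩, hq⟩ := hw
      refine ⟨⟨by rw [hτ0]; exact h1, fun j hj => ?_⟩, ?_⟩
      · obtain rfl : j = 1 := by fin_cases j <;> simp_all
        rw [hτ1]; exact h2 0 (by decide)
      · show planeEmb 3 (τ w) ∈ quietSet n (BondConfig.relabel (sym2Equiv σ) ω)
        rw [hquiet, hττ]; exact hq
    · rintro ⟨x, y, hx, hy, hpath⟩
      refine ⟨τ x, τ y, by rw [hτ1]; exact hx, by rw [hτ1]; exact hy, ?_⟩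
      refine DCT16.pathIn_map τ (fun w hw => ?_) (fun a b _ _ hab => hadjτ a b hab) hpath
      obtain ⟨⟨h1, h2⟩, hq⟩ := hw
      refine ⟨⟨by rw [hτ1]; exact h1, fun j hj => ?_⟩, ?_⟩
      · obtain rfl : j = 0 := by fin_cases j <;> simp_all
        rw [hτ0]; exact h2 1 (by decide)
      · show planeEmb 3 (τ w) ∈ quietSet n ω
        rw [← hquiet]; exact hq
  rw [hset]
  exact bondPercolation_real_preimage_relabel_iso (zdSignedPermIso (Equiv.swap (0 : Fin 3) 1) 1) p _

end PlanarArmedSections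

/-- **`p_c(ℤ³) < p_fin(3)` from the planar armed-section finite-size criterion at `p_c(ℤ³)`** (the registered open stub
`stub_planarArmedFSC` of line `planar-armed-sections`, verbatim, as hypothesis): if for every `ε > 0` there are scales
`1 ≤ n`, `2n < N` at which, under `P_{p_c}`, both origin rectangles `{0 ≤ w_k ≤ 2N, 0 ≤ w_j ≤ N (j ≠ k)} × {0}` are crossed
in direction `k` by a lattice path of `n`-quiet sites with probability `≥ 1 - ε`, then `p_c(ℤ³) < p_fin(3)`.
[cite: GrimmettHolroydKozma2014, §4 (proof of Thm. 5: block argument, dependent percolation, continuity in p)] -/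
theorem criticalProb_lt_pFin_of_planarQuietCrossings
    (hFSC : ∀ ε : ℝ, 0 < ε → ∃ n N : ℕ, 1 ≤ n ∧ 2 * n < N ∧ ∀ k : Fin 2,
      1 - ε ≤ (bondPercolation (zdGraph 3) (criticalProbI 3)).real
      {ω | ∃ x y : Site 2, x k = 0 ∧ y k = 2 * (N : ℤ) ∧
      PathIn (zdGraph 2) ({w : Site 2 | (0 ≤ w k ∧ w k ≤ 2 * (N : ℤ)) ∧
      ∀ j : Fin 2, j ≠ k → 0 ≤ w j ∧ w j ≤ (N : ℤ)} ∩ {w | planeEmb 3 w ∈ quietSet n ω}) x y}) :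
    criticalProb (zdGraph 3) 0 < pFin 3 := by
  obtain ⟨η₀, hη₀, hR⟩ :=
    stub_coarsePercolates stub_coarseLocality stub_coarseShift (stub_coarseFootprint stub_coarseLocality)
  obtain ⟨n, N, hn, hN, hpc⟩ := hFSC (η₀ / 2) (by positivity)
  set F : Fin 2 → unitInterval → ℝ := fun k p => (bondPercolation (zdGraph 3) p).real
    {ω | ∃ x y : Site 2, x k = 0 ∧ y k = 2 * (N : ℤ) ∧
      PathIn (zdGraph 2) ({w : Site 2 | (0 ≤ w k ∧ w k ≤ 2 * (N : ℤ)) ∧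
        ∀ j : Fin 2, j ≠ k → 0 ≤ w j ∧ w j ≤ (N : ℤ)} ∩ {w | planeEmb 3 w ∈ quietSet n ω}) x y} with hF
  -- (1) continuity of `F k` (shift-invariance + the event of the coarse origin is determined by a finite pair set)
  have hcont : ∀ k : Fin 2, Continuous (F k) := by
    intro k
    obtain ⟨hdet, hfin⟩ := stub_coarseLocality n N 0 k
    have h := continuous_bondPercolation_real_of_determinedBy (zdGraph 3) (F := hfin.toFinset)
      (by rwa [Set.Finite.coe_toFinset])
    refine (continuous_congr fun p => ?_).1 h
    exact stub_coarseShift p n N 0 k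
  -- (2) at `p_c` both exceed `1 - η₀` strictly, hence on a neighbourhood of `p_c` in `[0,1]`
  have hpc' : ∀ k : Fin 2, 1 - η₀ < F k (criticalProbI 3) := fun k => by
    have := hpc k
    simp only [hF]
    linarith
  have hev : ∀ᶠ p : unitInterval in 𝓝 (criticalProbI 3), ∀ k : Fin 2, 1 - η₀ < F k p :=
    Filter.eventually_all.2 fun k => Filter.Tendsto.eventually_const_lt (hpc' k) (hcont k).continuousAt
  obtain ⟨δ, hδ, hball⟩ := Metric.eventually_nhds_iff.1 hev
  -- (3) a parameter `q` with `p_c < q ≤ 1` inside that neighbourhood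
  have hpc1 : criticalProb (zdGraph 3) 0 < 1 := criticalProb_zd_lt_one (by norm_num)
  have hpc0 : 0 ≤ criticalProb (zdGraph 3) 0 := (criticalProb_mem_Icc (zdGraph 3) 0).1
  set q : ℝ := min 1 (criticalProb (zdGraph 3) 0 + δ / 2) with hq
  have hq0 : 0 ≤ q := le_min zero_le_one (by linarith)
  have hq1 : q ≤ 1 := min_le_left _ _
  have hqc : criticalProb (zdGraph 3) 0 < q := lt_min hpc1 (by linarith)
  have hdist : dist (⟨q, hq0, hq1⟩ : unitInterval) (criticalProbI 3) < δ := by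
    rw [Subtype.dist_eq, Real.dist_eq, coe_criticalProbI, abs_lt]
    constructor
    · linarith
    · linarith [min_le_right 1 (criticalProb (zdGraph 3) 0 + δ / 2)]
  have hdens : ∀ k : Fin 2, 1 - η₀ ≤ F k ⟨q, hq0, hq1⟩ := fun k => (hball hdist k).le
  -- (4) the coarse process percolates with positive probability at `q`
  have hcoarse := hR ⟨q, hq0, hq1⟩ n N hn hN (by simpa only [hF] using hdens)
  -- (5) gluing on the full-measure set `{ω ⊆ E(ℤ³)}`: an infinite coarse cluster is an infinite component of `X`
  have hX : 0 < (bondPercolation (zdGraph 3) ⟨q, hq0, hq1⟩).real (finiteClustersPercolate (zdGraph 3)) :=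
    hcoarse.trans_le (DCT16.real_mono_of_forall_subset_edgeSet (zdGraph 3) _
      fun ω hω h => stub_coarseToVacant stub_squareCrossings n N ω (by omega) hω h)
  -- (6) hence `q ≤ p_fin(3)` and `p_c(ℤ³) < p_fin(3)`
  exact hqc.trans_le (le_csSup (bddAbove_pFin_set 3) (Or.inl ⟨⟨hq0, hq1⟩, hX⟩))

/-- **ONE-PARAMETER FORM OF THE INPUT.** Since the criterion probability is non-decreasing in the arm scale
(`PlanarArmedSections.real_quietCross_mono`), `stub_planarArmedFSC` is EQUIVALENT to its instance at the largest admissible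
arm scale `n = (N - 1) / 2` (block scale `N ≥ 3`).  This direction: take `n := (N - 1) / 2`. [folklore] -/
theorem planarArmedFSC_of_halfScaleQuietCrossings
    (hHalf : ∀ ε : ℝ, 0 < ε → ∃ N : ℕ, 3 ≤ N ∧ ∀ k : Fin 2,
      1 - ε ≤ (bondPercolation (zdGraph 3) (criticalProbI 3)).real
      {ω | ∃ x y : Site 2, x k = 0 ∧ y k = 2 * (N : ℤ) ∧
      PathIn (zdGraph 2) ({w : Site 2 | (0 ≤ w k ∧ w k ≤ 2 * (N : ℤ)) ∧
      ∀ j : Fin 2, j ≠ k → 0 ≤ w j ∧ w j ≤ (N : ℤ)} ∩ {w | planeEmb 3 w ∈ quietSet ((N - 1) / 2) ω}) x y}) :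
    ∀ ε : ℝ, 0 < ε → ∃ n N : ℕ, 1 ≤ n ∧ 2 * n < N ∧ ∀ k : Fin 2,
      1 - ε ≤ (bondPercolation (zdGraph 3) (criticalProbI 3)).real
      {ω | ∃ x y : Site 2, x k = 0 ∧ y k = 2 * (N : ℤ) ∧
      PathIn (zdGraph 2) ({w : Site 2 | (0 ≤ w k ∧ w k ≤ 2 * (N : ℤ)) ∧
      ∀ j : Fin 2, j ≠ k → 0 ≤ w j ∧ w j ≤ (N : ℤ)} ∩ {w | planeEmb 3 w ∈ quietSet n ω}) x y} := by
  intro ε hε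
  obtain ⟨N, hN, h⟩ := hHalf ε hε
  exact ⟨(N - 1) / 2, N, by omega, by omega, h⟩

/-- Converse direction: the registered stub implies its one-parameter form (monotonicity in the arm scale,
`PlanarArmedSections.real_quietCross_mono`, with `n ≤ (N - 1) / 2` from `2n < N`). [folklore] -/
theorem halfScaleQuietCrossings_of_planarArmedFSC
    (hFSC : ∀ ε : ℝ, 0 < ε → ∃ n N : ℕ, 1 ≤ n ∧ 2 * n < N ∧ ∀ k : Fin 2,
      1 - ε ≤ (bondPercolation (zdGraph 3) (criticalProbI 3)).real
      {ω | ∃ x y : Site 2, x k = 0 ∧ y k = 2 * (N : ℤ) ∧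
      PathIn (zdGraph 2) ({w : Site 2 | (0 ≤ w k ∧ w k ≤ 2 * (N : ℤ)) ∧
      ∀ j : Fin 2, j ≠ k → 0 ≤ w j ∧ w j ≤ (N : ℤ)} ∩ {w | planeEmb 3 w ∈ quietSet n ω}) x y}) :
    ∀ ε : ℝ, 0 < ε → ∃ N : ℕ, 3 ≤ N ∧ ∀ k : Fin 2,
      1 - ε ≤ (bondPercolation (zdGraph 3) (criticalProbI 3)).real
      {ω | ∃ x y : Site 2, x k = 0 ∧ y k = 2 * (N : ℤ) ∧
      PathIn (zdGraph 2) ({w : Site 2 | (0 ≤ w k ∧ w k ≤ 2 * (N : ℤ)) ∧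
      ∀ j : Fin 2, j ≠ k → 0 ≤ w j ∧ w j ≤ (N : ℤ)} ∩ {w | planeEmb 3 w ∈ quietSet ((N - 1) / 2) ω}) x y} := by
  intro ε hε
  obtain ⟨n, N, hn, hnN, h⟩ := hFSC ε hε
  refine ⟨N, by omega, fun k => (h k).trans ?_⟩
  exact PlanarArmedSections.real_quietCross_mono (criticalProbI 3) (by omega) N k

/-- **SINGLE-ORIENTATION, ONE-PARAMETER FORM OF THE INPUT** (the cleanest promotable statement): for every `ε > 0`
there is a block scale `N ≥ 3` at which, under `P_{p_c(ℤ³)}`, the planar rectangle `[0,2N] × [0,N] × {0}` is crossed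
HORIZONTALLY by a lattice path of sites quiet at scale `(N-1)/2`, with probability `≥ 1 - ε`.  It gives the two-orientation
form by the direction symmetry `PlanarArmedSections.real_quietCross_dir_one_eq`. [folklore] -/
theorem halfScaleQuietCrossings_of_dir0
    (h0 : ∀ ε : ℝ, 0 < ε → ∃ N : ℕ, 3 ≤ N ∧
      1 - ε ≤ (bondPercolation (zdGraph 3) (criticalProbI 3)).real
      {ω | ∃ x y : Site 2, x 0 = 0 ∧ y 0 = 2 * (N : ℤ) ∧
      PathIn (zdGraph 2) ({w : Site 2 | (0 ≤ w 0 ∧ w 0 ≤ 2 * (N : ℤ)) ∧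
      ∀ j : Fin 2, j ≠ 0 → 0 ≤ w j ∧ w j ≤ (N : ℤ)} ∩ {w | planeEmb 3 w ∈ quietSet ((N - 1) / 2) ω}) x y}) :
    ∀ ε : ℝ, 0 < ε → ∃ N : ℕ, 3 ≤ N ∧ ∀ k : Fin 2,
      1 - ε ≤ (bondPercolation (zdGraph 3) (criticalProbI 3)).real
      {ω | ∃ x y : Site 2, x k = 0 ∧ y k = 2 * (N : ℤ) ∧
      PathIn (zdGraph 2) ({w : Site 2 | (0 ≤ w k ∧ w k ≤ 2 * (N : ℤ)) ∧
      ∀ j : Fin 2, j ≠ k → 0 ≤ w j ∧ w j ≤ (N : ℤ)} ∩ {w | planeEmb 3 w ∈ quietSet ((N - 1) / 2) ω}) x y} := by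
  intro ε hε
  obtain ⟨N, hN, h⟩ := h0 ε hε
  refine ⟨N, hN, fun k => ?_⟩
  obtain rfl | rfl : k = 0 ∨ k = 1 := by fin_cases k <;> simp
  · exact h
  · rw [PlanarArmedSections.real_quietCross_dir_one_eq]; exact h

/-- Converse (trivial): the two-orientation one-parameter form contains the horizontal one. [folklore] -/
theorem dir0_of_halfScaleQuietCrossings
    (hHalf : ∀ ε : ℝ, 0 < ε → ∃ N : ℕ, 3 ≤ N ∧ ∀ k : Fin 2,
      1 - ε ≤ (bondPercolation (zdGraph 3) (criticalProbI 3)).real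
      {ω | ∃ x y : Site 2, x k = 0 ∧ y k = 2 * (N : ℤ) ∧
      PathIn (zdGraph 2) ({w : Site 2 | (0 ≤ w k ∧ w k ≤ 2 * (N : ℤ)) ∧
      ∀ j : Fin 2, j ≠ k → 0 ≤ w j ∧ w j ≤ (N : ℤ)} ∩ {w | planeEmb 3 w ∈ quietSet ((N - 1) / 2) ω}) x y}) :
    ∀ ε : ℝ, 0 < ε → ∃ N : ℕ, 3 ≤ N ∧
      1 - ε ≤ (bondPercolation (zdGraph 3) (criticalProbI 3)).real
      {ω | ∃ x y : Site 2, x 0 = 0 ∧ y 0 = 2 * (N : ℤ) ∧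
      PathIn (zdGraph 2) ({w : Site 2 | (0 ≤ w 0 ∧ w 0 ≤ 2 * (N : ℤ)) ∧
      ∀ j : Fin 2, j ≠ 0 → 0 ≤ w j ∧ w j ≤ (N : ℤ)} ∩ {w | planeEmb 3 w ∈ quietSet ((N - 1) / 2) ω}) x y} := by
  intro ε hε
  obtain ⟨N, hN, h⟩ := hHalf ε hε
  exact ⟨N, hN, h 0⟩

/-- **`p_c(ℤ³) < p_fin(3)` from the SINGLE-ORIENTATION ONE-PARAMETER planar quiet-crossing criterion at `p_c(ℤ³)`.**
[cite: GrimmettHolroydKozma2014, §4 (Thm. 5)] -/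
theorem criticalProb_lt_pFin_of_dir0HalfScaleQuietCrossings
    (h0 : ∀ ε : ℝ, 0 < ε → ∃ N : ℕ, 3 ≤ N ∧
      1 - ε ≤ (bondPercolation (zdGraph 3) (criticalProbI 3)).real
      {ω | ∃ x y : Site 2, x 0 = 0 ∧ y 0 = 2 * (N : ℤ) ∧
      PathIn (zdGraph 2) ({w : Site 2 | (0 ≤ w 0 ∧ w 0 ≤ 2 * (N : ℤ)) ∧
      ∀ j : Fin 2, j ≠ 0 → 0 ≤ w j ∧ w j ≤ (N : ℤ)} ∩ {w | planeEmb 3 w ∈ quietSet ((N - 1) / 2) ω}) x y}) :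
    criticalProb (zdGraph 3) 0 < pFin 3 :=
  criticalProb_lt_pFin_of_planarQuietCrossings
    (planarArmedFSC_of_halfScaleQuietCrossings (halfScaleQuietCrossings_of_dir0 h0))

/-- **The crux from the SINGLE-ORIENTATION ONE-PARAMETER criterion**: if for every `ε > 0` some `N ≥ 3` has
`P_{p_c(ℤ³)}([0,2N] × [0,N] × {0}` is crossed horizontally by `(N-1)/2`-quiet sites`) ≥ 1 - ε`, then `VacantSetPercolates`.
This hypothesis is EQUIVALENT to the registered open stub `stub_planarArmedFSC` (the four conversion theorems of this file).
[cite: GrimmettHolroydKozma2014, §4 (Thm. 5)] -/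
theorem vacantSetPercolates_of_dir0HalfScaleQuietCrossings
    (h0 : ∀ ε : ℝ, 0 < ε → ∃ N : ℕ, 3 ≤ N ∧
      1 - ε ≤ (bondPercolation (zdGraph 3) (criticalProbI 3)).real
      {ω | ∃ x y : Site 2, x 0 = 0 ∧ y 0 = 2 * (N : ℤ) ∧
      PathIn (zdGraph 2) ({w : Site 2 | (0 ≤ w 0 ∧ w 0 ≤ 2 * (N : ℤ)) ∧
      ∀ j : Fin 2, j ≠ 0 → 0 ≤ w j ∧ w j ≤ (N : ℤ)} ∩ {w | planeEmb 3 w ∈ quietSet ((N - 1) / 2) ω}) x y}) :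
    Summit.CriticalPhenomena.PercolationContinuityZ3.Theses.PercBurnResprinkle.VacantSetPercolates :=
  (criticalProb_lt_pFin_iff 3).1 (criticalProb_lt_pFin_of_dir0HalfScaleQuietCrossings h0)

/-- The crux from the two-orientation one-parameter criterion. [cite: GrimmettHolroydKozma2014, §4 (Thm. 5)] -/
theorem vacantSetPercolates_of_halfScaleQuietCrossings
    (hHalf : ∀ ε : ℝ, 0 < ε → ∃ N : ℕ, 3 ≤ N ∧ ∀ k : Fin 2,
      1 - ε ≤ (bondPercolation (zdGraph 3) (criticalProbI 3)).real
      {ω | ∃ x y : Site 2, x k = 0 ∧ y k = 2 * (N : ℤ) ∧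
      PathIn (zdGraph 2) ({w : Site 2 | (0 ≤ w k ∧ w k ≤ 2 * (N : ℤ)) ∧
      ∀ j : Fin 2, j ≠ k → 0 ≤ w j ∧ w j ≤ (N : ℤ)} ∩ {w | planeEmb 3 w ∈ quietSet ((N - 1) / 2) ω}) x y}) :
    Summit.CriticalPhenomena.PercolationContinuityZ3.Theses.PercBurnResprinkle.VacantSetPercolates :=
  vacantSetPercolates_of_dir0HalfScaleQuietCrossings (dir0_of_halfScaleQuietCrossings hHalf)

/-- **The crux modulo its one open stub**: the route decl `VacantSetPercolates` follows from the planar armed-section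
finite-size criterion at `p_c(ℤ³)` (hypothesis = the registered stub `stub_planarArmedFSC`, verbatim), through its
one-parameter single-orientation form. [cite: GrimmettHolroydKozma2014, §4 (Thm. 5, p_c < p_fin from a finite-size input)] -/
theorem vacantSetPercolates_of_planarArmedFSC
    (hFSC : ∀ ε : ℝ, 0 < ε → ∃ n N : ℕ, 1 ≤ n ∧ 2 * n < N ∧ ∀ k : Fin 2,
      1 - ε ≤ (bondPercolation (zdGraph 3) (criticalProbI 3)).real
      {ω | ∃ x y : Site 2, x k = 0 ∧ y k = 2 * (N : ℤ) ∧
      PathIn (zdGraph 2) ({w : Site 2 | (0 ≤ w k ∧ w k ≤ 2 * (N : ℤ)) ∧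
      ∀ j : Fin 2, j ≠ k → 0 ≤ w j ∧ w j ≤ (N : ℤ)} ∩ {w | planeEmb 3 w ∈ quietSet n ω}) x y}) :
    Summit.CriticalPhenomena.PercolationContinuityZ3.Theses.PercBurnResprinkle.VacantSetPercolates :=
  vacantSetPercolates_of_halfScaleQuietCrossings (halfScaleQuietCrossings_of_planarArmedFSC hFSC)

/-- **Registered transfer stub of the line** (`stub_planarArmedSectionsTransfer`, registered on stmt-CriticalPhenomena-7205): the open input
`stub_planarArmedFSC` (verbatim) implies the crux decl by name — `vacantSetPercolates_of_planarArmedFSC` restated in the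
registry's arrow form. [cite: GrimmettHolroydKozma2014, §4 (Thm. 5)] -/
theorem stub_planarArmedSectionsTransfer :
    (∀ ε : ℝ, 0 < ε → ∃ n N : ℕ, 1 ≤ n ∧ 2 * n < N ∧ ∀ k : Fin 2,
      1 - ε ≤ (bondPercolation (zdGraph 3) (criticalProbI 3)).real
      {ω | ∃ x y : Site 2, x k = 0 ∧ y k = 2 * (N : ℤ) ∧
      PathIn (zdGraph 2) ({w : Site 2 | (0 ≤ w k ∧ w k ≤ 2 * (N : ℤ)) ∧
      ∀ j : Fin 2, j ≠ k → 0 ≤ w j ∧ w j ≤ (N : ℤ)} ∩ {w | planeEmb 3 w ∈ quietSet n ω}) x y}) →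
    Summit.CriticalPhenomena.PercolationContinuityZ3.Theses.PercBurnResprinkle.VacantSetPercolates :=
  fun h => vacantSetPercolates_of_planarArmedFSC h

end Summit.CriticalPhenomena.PercolationContinuityZ3.Theorems

end
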